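import Summits.BirchSwinnertonDyer.Rank1Residual.AdditivePotMult.PotMultBranchPAdicGrossZagierIffRouteG
import Summits.BirchSwinnertonDyer.Rank1Residual.Additive.CongruentPartnerBranchPAdicGrossZagierIff
import Summits.BirchSwinnertonDyer.Rank1Residual.Additive.GordRankOneKatoCertificateBSD
import HarnessLib

/-!
# X4(M) ∧ surj(p) ∧ `r_an = 1`, EVERY odd `p` (`p = 3` included): on the INDEX-`n₀` rows of Route G the
# `p`-part of BSD is ONE valuation statement — `BSD(E,p) ⟺ ord_p q + ord_p Reg_p(E,Dh) = 1 + v₁`,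
# `v₁ = ord_p [T¹](ϖ·L_p^±(f_{E♭}, ±1, ω^{(p−1)/2}, T))` — and the EXACT `ℓ`-free identity
# `ord_p #Ш(E) + ord_p Reg_p(E,Dh) + ord_p ∏c_ℓ = v₁ + 1 + 2·ord_p #E(ℚ)_tors` per admissible datum
# (cell `b2b-bsdres`, team n1011, seat p07 (gen 3), row T-E3gM = ROUTE-2 §II.12.1 (v) (M) half,
# dealt by lead GEN 6 R5-30; FILE 2d of T-E3dM, sequel of `PotMultBranchPAdicGrossZagierIffRouteG.lean`,
# over n1011-p01's T-E3g (ii) rider `Additive/CongruentPartnerBranchPAdicGrossZagierIff.lean` BY NAME)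

HONEST FRAMING (cell `b2b-bsdres`, run/shared/lean/b2b/bsd-rank1-residual/, verbatim in every
file): the goal of the cell is to DELETE the COMBINATION-SHAPED residual classes of the
Birch–Swinnerton-Dyer formula for ALL analytic-rank `≤ 1` elliptic curves over `ℚ` — "full BSD
formula for every rank `≤ 1` curve in class `C`" assembled STRICTLY from published theorems — so
that the rank-`≤ 1` remainder becomes exactly the CONSTRUCTION-SHAPED classes, which are TYPED
(missing-input `Prop`s), NOT attempted. This is not "finishing BSD". Team n1011 (RESIDUAL-MAP §I O7-ord
on the (M) rows = X4(M) ∧ surj(p) ∧ `r_an = 1`, every odd `p`): research route on CONSTRUCTION-SHAPED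
items; O7-ord stays OPEN and CONSTRUCTION-SHAPED; labels and marks UNCHANGED; nothing booked — the
OUTPUT is an EQUIVALENCE of `BSD(E,p)` with ONE `p`-adic valuation per (B)-datum (`Reg_p(E,Dh)` has NO
engine in the cell), NOT `BSD(E,p)`; every statement is PER PAIR modulo the named facts AND per-pair
inputs outside the kernel: the census record at index `n₀` (CERTIFICATE-EVIDENCE, two engines), the
budget (n1011-p10's typed `BudgetLeLambdaAt`, EPW 2006 §3 per curve; a theorem when `n₀ ≤ rank`), the
ONE-SIDED bit `c₁ ≠ 0` and its valuation `v₁` for the datum at hand. NO Literature fact minted; NO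
definition. Named facts as HYPOTHESES only: `hK` (Kato 2004 Thm. 17.4 (3) half-eigenspace reading
`Wuthrich2014.kato_halfEigenCharIdeal_dvd_cyclotomicPrime_of_surjective`), `hGZK`, `hmod`. Debt 0.

## What and why (ROUTE-2 §II.12.1 (iv)–(v), r2 GEN 6)

On an `r_an = 1` (M) row, Route G's K-OUT (`charIdeal_eq_span_of_katoHalf_of_norm_coeff_of_budget`,
`PotMultKatoFirstUnitIndex` §1: `char_Λ X(E/ℚ_∞) = (g)`, `ι g = C(u·ϖ)·B` from Kato's divisibility + the
record's unit at index `n₀` + `BudgetLeLambdaAt p W n₀`) feeds n1011-p01's cell-agnostic T-E3g (ii)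
rider `schneider_and_padicVal_identity_rankOne_of_charIdeal_eq_span_of_iota_eq` (`char = (g)` +
`[T¹](ϖ·B) ≠ 0` + `rank = 1` ⟹ Schneider ∧ `Ш[p^∞]` finite ∧ the EXACT identity with `v₁`); on (M)
`ℓ_p = 1` (`PotMult.reductionNonAnomalous`) and `Ш(E)` is finite by GZK:

* §1 `norm_coeff_multBranch_eq_one_of_firstUnitIndex`: the record's clause (2) at index `n` for a given
  multiplicative twist datum, parity-uniform (the norm-`1` companion of
  `coeff_multBranch_ne_zero_of_firstUnitIndex`).
* §2 `ClassX4M.schneider_and_padicVal_identity_rankOne_of_katoHalf_of_firstUnitIndex_of_budget`: for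
  every multiplicative twist datum `(V, C, f, a_p, ϖ)` with `[T¹](ϖ·B) ≠ 0` and every (B)-datum `Dh`:
  Schneider and **`ord_p #Ш(E) + ord_p Reg_p(E,Dh) + ord_p ∏c_ℓ = v₁ + 1 + 2·ord_p #E(ℚ)_tors`**
  (`v₁ = 0` recovers T-O7KM's `…identity_rankOne_of_katoHalf_of_multCert`).
* §3 HEADLINE `ClassX4M.bsdp_iff_padicVal_rankOne_of_katoHalf_of_firstUnitIndex_of_budget`: with
  `L'(E,1) = q·Ω_E·Reg_∞(E)`, **`BSD(E,p) ⟺ ord_p q + ord_p Reg_p(E,Dh) = 1 + v₁`** — the `p`-adic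
  Gross–Zagier VALUATION statement at the additive prime, licensed on index-`n₀` rows (the T-O7KM
  headline is the case `n₀ = 1`, `v₁ = 0`); X4-2's census reading `ord_p A′ = v₁ + 1` holds verbatim.

What is NOT claimed: `BSD(E,p)` on any row; `v(Reg_p)` (no engine); the record / budget / bit inputs
(instrument tier, per pair); rows with `n₀ > m(B)` and no partner; non-surjective rows (O8); `p = 2`.
Nothing booked; no number closes anything.

References: K. Kato, Astérisque 295 (2004) Thm. 17.4 (3) [Kato2004Asterisque]; D. Delbourgo,
J. Number Theory 95 (2002) Thm. (B) [Delbourgo2002]; M. Emerton, R. Pollack, T. Weston, Invent. Math.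
163 (2006) §3 [EmertonPollackWeston2006]; B. Mazur, J. Tate, J. Teitelbaum, Invent. Math. 84 (1986)
§I.13 [MazurTateTeitelbaum1986Invent]; R. L. Miller, LMS J. Comput. Math. 14 (2011) Def. 1.1
[Miller2011LMS]; L. Washington, GTM 83 (1997) §7.1 [Washington1997].
-/

set_option autoImplicit false

noncomputable section

open scoped Classical MatrixGroups ModularForm NumberField

namespace Summit.BirchSwinnertonDyer.Rank1Residual.AdditivePotMult

open CongruenceSubgroup WeierstrassCurve NumberField Literature.NumberTheory.EllipticCurves
  Literature.NumberTheory.EllipticCurves.ModularForms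
  Literature.NumberTheory.EllipticCurves.Rank1Residual
  Literature.NumberTheory.EllipticCurves.Rank1Residual.Typed
  Literature.NumberTheory.EllipticCurves.Delbourgo2002
  Literature.NumberTheory.GaloisRepresentations
  Summit.BirchSwinnertonDyer.Rank1Residual.Additive
  Summit.BirchSwinnertonDyer.Rank1Residual.Additive.CensusQ6
  IsDedekindDomain

/-! ### §1 The record's unit at index `n` for a given twist datum (parity-uniform) -/

section Record

variable {W : WeierstrassCurve ℚ} {p : ℕ} [hp : Fact p.Prime]

/-- **Clause (2) of the record at index `n`, parity-uniform form**: on every multiplicative twist datum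
`(V, C, f, a_p, ϖ)` of `W`, `‖[Tⁿ](ϖ·L_p^±(f, a_p, ω^{(p−1)/2}, T))‖_p = 1` for the branch of the parity of
`(p−1)/2`. [cite: MazurTateTeitelbaum1986Invent, §I.13 (the branch series)] -/
theorem norm_coeff_multBranch_eq_one_of_firstUnitIndex (hp2 : p ≠ 2) {n : ℕ}
    (hrec : (p % 4 = 1 → MultFirstUnitIndexAt W p n) ∧ (p % 4 = 3 → MultOddFirstUnitIndexAt W p n))
    (V : WeierstrassCurve ℚ) [V.IsElliptic] [V.IsGloballyMinimal] (C : VariableChange ℚ)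
    (hV : Mult V p) (hC : C • V.quadraticTwist ((-1 : ℚ) ^ (p / 2) * p) = W)
    {N : ℕ} [NeZero N] (f : CuspForm (Gamma0 N) 2) (hf : IsNewformOf V f) (ap : ℤ)
    (hap : cuspCoeff f p = ap) (ϖ : ℚ)
    (hϖ : if Even (p / 2) then (ϖ : ℝ) * V.realPeriodRat = plusPeriod f
      else (ϖ : ℝ) * V.imaginaryPeriodRat = minusPeriod f) :
    ‖PowerSeries.coeff n (PowerSeries.C (ϖ : ℚ_[p]) *
        (if Even (p / 2) then padicLFunctionPlusBranchMult f (ap : ℚ_[p]) (p / 2)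
          else padicLFunctionMinusBranchMult f (ap : ℚ_[p]) (p / 2)))‖ = 1 := by
  have h4 : p % 4 = 1 ∨ p % 4 = 3 := by
    obtain ⟨k, hk⟩ := hp.out.odd_of_ne_two hp2
    omega
  rcases h4 with h1 | h3
  · have heven : Even (p / 2) := ⟨p / 4, by omega⟩
    have hC' : C • V.quadraticTwist (p : ℚ) = W := by
      rw [pStar_eq_self_of_mod_four_eq_one h1] at hC; exact hC
    rw [if_pos heven] at hϖ ⊢
    exact (hrec.1 h1 V C hV hC' f hf ap hap ϖ hϖ).2
  · have hodd : ¬ Even (p / 2) := by rw [Nat.not_even_iff_odd]; exact ⟨p / 4, by omega⟩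
    have hC' : C • V.quadraticTwist (-(p : ℚ)) = W := by
      rw [pStar_eq_neg_of_mod_four_eq_three h3] at hC; exact hC
    rw [if_neg hodd] at hϖ ⊢
    exact (hrec.2 h3 V C hV hC' f hf ap hap ϖ hϖ).2

end Record

/-! ### §2 The EXACT `v₁`-identity per admissible datum on the index-`n₀` (M) rows -/

section Identity

variable {W : WeierstrassCurve ℚ} [W.IsElliptic] [W.IsGloballyMinimal] {p : ℕ} [hp : Fact p.Prime]

/-- **T-E3gM (ii) on the rows: the EXACT `v₁`-identity per admissible datum.** X4(M) ∧ surj(p) ∧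
`r_an = 1`, EVERY odd `p` (`p = 3` included); Kato's half `hK` + the census record at index `n₀` + the
budget `BudgetLeLambdaAt p W n₀` (K-OUT: `char_Λ X(E/ℚ_∞) = (g)`, `ι g = C(u·ϖ)·B`,
`charIdeal_eq_span_of_katoHalf_of_norm_coeff_of_budget`) + `[T¹](ϖ·B) ≠ 0` for THIS multiplicative twist
datum `(V, C, f, a_p, ϖ)` (`hne`, one-sided bit) ⟹ for every (B)-datum `Dh`: Schneider and
`ord_p #Ш(E) + ord_p Reg_p(E,Dh) + ord_p ∏c_ℓ = v_p([T¹](ϖ·B)) + 1 + 2·ord_p #E(ℚ)_tors` — n1011-p01's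
T-E3g (ii) rider BY NAME, with `ℓ_p = 1` on (M) (`PotMult.reductionNonAnomalous`) and `Ш(E)` finite
(GZK). `v₁ = 0` (index-`1` UNIT rows) is T-O7KM's `…identity_rankOne_of_katoHalf_of_multCert`.
[cite: Delbourgo2002, Theorem (B) (p. 40), ℓ_p(E) = 1 (p. 39)] [cite: Kato2004Asterisque, Thm. 17.4 (3) (p. 273)]
[cite: EmertonPollackWeston2006, Cor. 3.2.5 and Thm. 3.1.1 (source of the typed input)] [cite: Washington1997, §7.1] -/
theorem ClassX4M.schneider_and_padicVal_identity_rankOne_of_katoHalf_of_firstUnitIndex_of_budget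
    (hK : Wuthrich2014.kato_halfEigenCharIdeal_dvd_cyclotomicPrime_of_surjective)
    (hGZK : rank_eq_analyticRank_of_analyticRank_le_one)
    (hX : ClassX4M W p) (hsurj : Surj W p) (hr : W.analyticRank = 1) {n₀ : ℕ}
    (hrec : (p % 4 = 1 → MultFirstUnitIndexAt W p n₀) ∧ (p % 4 = 3 → MultOddFirstUnitIndexAt W p n₀))
    (hbud : BudgetLeLambdaAt p W n₀)
    (V : WeierstrassCurve ℚ) [V.IsElliptic] [V.IsGloballyMinimal] (C : VariableChange ℚ)
    (hV : Mult V p) (hC : C • V.quadraticTwist ((-1 : ℚ) ^ (p / 2) * p) = W)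
    {N : ℕ} [NeZero N] {f : CuspForm (Gamma0 N) 2} (hf : IsNewformOf V f) (ap : ℤ)
    (hap : cuspCoeff f p = ap) (ϖ : ℚ)
    (hϖ : if Even (p / 2) then (ϖ : ℝ) * V.realPeriodRat = plusPeriod f
      else (ϖ : ℝ) * V.imaginaryPeriodRat = minusPeriod f)
    (hne : PowerSeries.coeff 1 (PowerSeries.C (ϖ : ℚ_[p]) *
      (if Even (p / 2) then padicLFunctionPlusBranchMult f (ap : ℚ_[p]) (p / 2)
        else padicLFunctionMinusBranchMult f (ap : ℚ_[p]) (p / 2))) ≠ 0)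
    {Dh : PAdicHeightData W p} (hB : LeadingTermClauses W p Dh) :
    SchneiderConjecture Dh ∧
      (padicValNat p W.shaOrder : ℤ) + (padicRegulator Dh).valuation + padicValNat p W.tamagawaProduct =
        (PowerSeries.coeff 1 (PowerSeries.C (ϖ : ℚ_[p]) *
            (if Even (p / 2) then padicLFunctionPlusBranchMult f (ap : ℚ_[p]) (p / 2)
              else padicLFunctionMinusBranchMult f (ap : ℚ_[p]) (p / 2)))).valuation +
          1 + 2 * padicValNat p W.torsionOrder := by
  have hp2 : p ≠ 2 := hX.p_ne_two
  obtain ⟨hmw, hfinSha⟩ := hGZK W (by rw [hr])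
  have hr1 : W.mordellWeilRank = 1 := by rw [hmw, hr]
  haveI : Finite W.sha := hfinSha
  have hsurjV : ∀ n : ℕ, V.HasSurjectiveModNGaloisRep (p ^ n : ℕ) :=
    (ClassX4M.potMult W p hX).towerSurj_twist_of_surj hp2 hsurj V C hC
  obtain ⟨κ, hκ, γ, hγ, hγ'⟩ := exists_isCyclotomic_isTopGenerator_isCyclotomicVariable_holds p
  obtain ⟨D⟩ := W.nonempty_selmerDualData_holds κ γ hγ
  haveI : Module.Finite (IwasawaAlgebra p) D.X := D.module_finite_holds hγ
  -- the record's unit at index `n₀` for this datum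
  have hn := norm_coeff_multBranch_eq_one_of_firstUnitIndex hp2 hrec V C hV hC f hf ap hap ϖ hϖ
  -- `a_p(E♭) = ±1`: put the series in the literal shape of the brick's disjunction
  by_cases hs : V.HasSplitMultiplicativeReductionAtPrime p
  · obtain ⟨h1, -⟩ := hf.cuspCoeff_eq_one_and_sq_of_split hs
    have hap1 : (ap : ℚ_[p]) = 1 := by
      have : ((ap : ℤ) : ℂ) = ((1 : ℤ) : ℂ) := by push_cast; exact_mod_cast hap.symm.trans h1
      have hZ : ap = 1 := by exact_mod_cast this
      rw [hZ, Int.cast_one]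
    rw [hap1] at hn hne ⊢
    obtain ⟨hXt, g, hchar, ⟨u, hι⟩, -, -, -⟩ := charIdeal_eq_span_of_katoHalf_of_norm_coeff_of_budget hK
      hp2 hbud V C hC hsurjV hκ hγ hγ' hf D _ (Or.inr (Or.inl ⟨hs, rfl⟩)) ϖ hϖ hn
    obtain ⟨hS, -, ℓ, -, hℓ1, hid⟩ :=
      schneider_and_padicVal_identity_rankOne_of_charIdeal_eq_span_of_iota_eq hp2 hr1 hB hκ hγ hγ' D hXt
        hchar hι hne
    refine ⟨hS, ?_⟩
    rw [hℓ1 (ClassX4M.potMult W p hX).reductionNonAnomalous, padicValNat_one_right, Nat.cast_zero,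
      add_zero, padicValNat_card_addPrimaryComponent] at hid
    exact hid
  · obtain ⟨h1, -⟩ := hf.cuspCoeff_eq_neg_one_and_dvd_of_nonsplit hV hs
    have hap1 : (ap : ℚ_[p]) = -1 := by
      have : ((ap : ℤ) : ℂ) = ((-1 : ℤ) : ℂ) := by push_cast; exact_mod_cast hap.symm.trans h1
      have hZ : ap = -1 := by exact_mod_cast this
      rw [hZ, Int.cast_neg, Int.cast_one]
    rw [hap1] at hn hne ⊢
    obtain ⟨hXt, g, hchar, ⟨u, hι⟩, -, -, -⟩ := charIdeal_eq_span_of_katoHalf_of_norm_coeff_of_budget hK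
      hp2 hbud V C hC hsurjV hκ hγ hγ' hf D _ (Or.inr (Or.inr ⟨hV, hs, rfl⟩)) ϖ hϖ hn
    obtain ⟨hS, -, ℓ, -, hℓ1, hid⟩ :=
      schneider_and_padicVal_identity_rankOne_of_charIdeal_eq_span_of_iota_eq hp2 hr1 hB hκ hγ hγ' D hXt
        hchar hι hne
    refine ⟨hS, ?_⟩
    rw [hℓ1 (ClassX4M.potMult W p hX).reductionNonAnomalous, padicValNat_one_right, Nat.cast_zero,
      add_zero, padicValNat_card_addPrimaryComponent] at hid
    exact hid

/-! ### §3 HEADLINE: `BSD(E,p) ⟺ ord_p q + ord_p Reg_p(E,Dh) = 1 + v₁` on the index-`n₀` (M) rows -/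

/-- **HEADLINE (X4(M) ∧ surj(p) ∧ `r_an = 1`, EVERY odd `p`, `p = 3` included): on an index-`n₀` row of
Route G, `BSD(E,p) ⟺ ord_p q + ord_p Reg_p(E,Dh) = 1 + v₁`** for every (B)-datum `Dh`, where
`L'(E,1) = q·Ω_E·Reg_∞(E)` and `v₁ = v_p([T¹](ϖ·B))` for the twist datum at hand — GIVEN Kato's
divisibility, the census record at `n₀`, the budget `BudgetLeLambdaAt p W n₀` and the bit `[T¹](ϖ·B) ≠ 0`.
`Ш` has disappeared: the residue of `BSD(E,p)` on these rows is ONE `p`-adic valuation (the typed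
`p`-adic Gross–Zagier at the additive prime as an integer per pair). T-O7KM's headline
`ClassX4M.bsdp_iff_padicVal_rankOne_of_katoHalf_of_multCert` is the case `n₀ = 1`, `v₁ = 0`. Nothing
booked; O7-ord OPEN. [cite: Delbourgo2002, Theorem (B) (p. 40)] [cite: Kato2004Asterisque, Thm. 17.4 (3) (p. 273)]
[cite: Miller2011LMS, Def. 1.1] [cite: EmertonPollackWeston2006, Cor. 3.2.5 and Thm. 3.1.1 (source of the typed input)] -/
theorem ClassX4M.bsdp_iff_padicVal_rankOne_of_katoHalf_of_firstUnitIndex_of_budget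
    (hK : Wuthrich2014.kato_halfEigenCharIdeal_dvd_cyclotomicPrime_of_surjective)
    (hGZK : rank_eq_analyticRank_of_analyticRank_le_one) (hmod : hasEntireLFunction_rat)
    (hX : ClassX4M W p) (hsurj : Surj W p) (hr : W.analyticRank = 1) {n₀ : ℕ}
    (hrec : (p % 4 = 1 → MultFirstUnitIndexAt W p n₀) ∧ (p % 4 = 3 → MultOddFirstUnitIndexAt W p n₀))
    (hbud : BudgetLeLambdaAt p W n₀)
    (V : WeierstrassCurve ℚ) [V.IsElliptic] [V.IsGloballyMinimal] (C : VariableChange ℚ)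
    (hV : Mult V p) (hC : C • V.quadraticTwist ((-1 : ℚ) ^ (p / 2) * p) = W)
    {N : ℕ} [NeZero N] {f : CuspForm (Gamma0 N) 2} (hf : IsNewformOf V f) (ap : ℤ)
    (hap : cuspCoeff f p = ap) (ϖ : ℚ)
    (hϖ : if Even (p / 2) then (ϖ : ℝ) * V.realPeriodRat = plusPeriod f
      else (ϖ : ℝ) * V.imaginaryPeriodRat = minusPeriod f)
    (hne : PowerSeries.coeff 1 (PowerSeries.C (ϖ : ℚ_[p]) *
      (if Even (p / 2) then padicLFunctionPlusBranchMult f (ap : ℚ_[p]) (p / 2)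
        else padicLFunctionMinusBranchMult f (ap : ℚ_[p]) (p / 2))) ≠ 0)
    {Dh : PAdicHeightData W p} (hB : LeadingTermClauses W p Dh)
    {q : ℚ} (hLq : W.leadingLCoeff = (q : ℂ) * (W.realPeriodRat : ℂ) * (W.regulator : ℂ)) :
    BSDp W p ↔
      padicValRat p q + (padicRegulator Dh).valuation =
        1 + (PowerSeries.coeff 1 (PowerSeries.C (ϖ : ℚ_[p]) *
            (if Even (p / 2) then padicLFunctionPlusBranchMult f (ap : ℚ_[p]) (p / 2)
              else padicLFunctionMinusBranchMult f (ap : ℚ_[p]) (p / 2)))).valuation := by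
  obtain ⟨-, hid⟩ := hX.schneider_and_padicVal_identity_rankOne_of_katoHalf_of_firstUnitIndex_of_budget hK
    hGZK hsurj hr hrec hbud V C hV hC hf ap hap ϖ hϖ hne hB
  have hq0 : q ≠ 0 := by
    rintro rfl
    rw [Rat.cast_zero, zero_mul, zero_mul] at hLq
    exact W.leadingLCoeff_ne_zero_holds (hmod W) hLq
  set v₁ := (PowerSeries.coeff 1 (PowerSeries.C (ϖ : ℚ_[p]) *
      (if Even (p / 2) then padicLFunctionPlusBranchMult f (ap : ℚ_[p]) (p / 2)
        else padicLFunctionMinusBranchMult f (ap : ℚ_[p]) (p / 2)))).valuation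
  have hid' : (padicValNat p W.shaOrder : ℤ) + ((padicRegulator Dh).valuation - v₁) +
      padicValNat p W.tamagawaProduct = 1 + 2 * padicValNat p W.torsionOrder := by
    linarith
  have h := bsdp_iff_padicValRat_add_eq_one (W := W) (p := p) hGZK (by rw [hr]) hq0 hLq hid'
  rw [h]
  constructor <;> intro h' <;> linarith

end Identity

end Summit.BirchSwinnertonDyer.Rank1Residual.AdditivePotMult

end
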